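/-
Copyright (c) 2026. All rights reserved.
Released under Apache 2.0 license as described in the file LICENSE.
Authors: abc-iut cell, F-wave seat abc-iut-f-101 (gen 6), over abc-iut-L4-t6's archimedean `⋉`-carrier of record
(`Ltimes/LogFrobeniusArchGenuinePlus`), abc-iut-w4-d095's Aut-holomorphic models (`HolTFPair.iotaTimes` / `inclTimes`,
`LogFrobeniusLogWallArchOrigin`) and abc-iut-L4-t8's `TH⊞`-lift (`HolTFPair.iotaTimesPlus`, `iotaTimesPlus_forgetTH`).
-/
import Literature.AnabelianGeometry.AbsoluteAnabelian.Ltimes.LogFrobeniusSettingSumLtimesIotaOver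
import HarnessLib

/-!
# [AbsTopIII] Def 5.4 (vii): the `TS`-valued `ι_{v,ε}` ON THE ARCHIMEDEAN `⋉`-CARRIER OF RECORD

S. Mochizuki, *Topics in absolute anabelian geometry III*, J. Math. Sci. Univ. Tokyo 22 (2015) [MochizukiAbsTopIII2015],
Def 5.4 (v) p. 127 (`Γ⃗^log_arc = (k~ →(id) k~ ↠ k^× ↪ k)`, `Γ⃗^⋉_arc` without the last arrow), Def 5.4 (vii) p. 128
(«natural transformations `ι⊞_{v,ε}` … `ι_{v,ε}` …»; the `TS`-valued `ι` run along EVERY edge of `Γ⃗^log_v`, the `⊞`-valued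
ones along the edges of `Γ⃗^⋉_v` only, and agree there after `𝒞^hol_{TH⊞} → 𝒞^hol_TH`).

Cell slice T9-E / row «s_b′@SUM» P2 (L4-lead m213/m214): a `TS`-DATUM on abc-iut-L4-t6's carrier `archGenuinePlus 𝔄 V isArc`
(an inhabitant of abc-iut-L4-t3's `LogFrobeniusSettingLtimes.TSHomotopies` there) and its add-on law `IotaOverTS`:
* `archIotaTSPlusCore` — on ALL edges of `Γ⃗^log_v`, at the `TH` level (after `forgetTH`): identity along `k~ → k~`, the universal
  covering `exp_k` along the shell arrow (abc-iut-L4-t8's `iotaTimesPlus`, forgotten to `TH` — which IS abc-iut-w4-d095's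
  `iotaTimes`, `iotaTimesPlus_forgetTH`), the natural inclusion `k^× ↪ k` along the space-link arrow (abc-iut-w4-d095's
  `inclTimes` — the arrow the `⊞`-side of the successor does NOT carry); stand-in identities at nonarchimedean places of THIS
  carrier (as in the carrier itself, (L2));
* ★ `archGenuinePlusTS` — the `TS`-datum (`iota_toTS`: on `Γ⃗^⋉_v` it is `ι⊞ ▹ (𝒩⊞_v → 𝒩_v)` on the nose);
* ★ `archGenuinePlus_iotaOverTS` — its `ι` lie over `Th•[Z] = EA` (every structure isomorphism of the carrier is `Iso.refl`; the
  `EA`-components of `exp_k` and of `k^× ↪ k` are the identity of the structure-orbispace).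
MODEL-LEVEL; refereed pre-IUT material; nothing here bears on [IUTchIII] Cor. 3.12; no side taken; typed ≠ proved.
-/

set_option autoImplicit false

universe u

open CategoryTheory

namespace Literature.AnabelianGeometry.AbsoluteAnabelian

namespace LogFrobeniusSettingLtimes

section ArchTS

variable (𝔄 : AutHolFieldFunctor.{u})

/-- `TS`-valued `ι_{v,ε}` before the twist, on ALL edges of `Γ⃗^log_v`, at the `TH` level of abc-iut-L4-t6's carrier: along
`k~ →(id) k~` the identity, along `k~ ↠ k^×` the universal covering `exp_k` (`iotaTimesPlus` forgotten to `TH`), along `k^× ↪ k`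
the natural inclusion (`inclTimes`); stand-in identities at a nonarchimedean place. [cite: MochizukiAbsTopIII2015, Def 5.4 (vii) p. 128] -/
noncomputable def archIotaTSPlusCore : (b : Bool) → {ν₁ ν₂ : LogVertex b} → LogEdgeTS b ν₁ ν₂ →
    (archLamPlus 𝔄 b ν₁ ⋙ Up.liftF (HolTHPlusPair.forgetTH 𝔄) ⟶ archLamPlus 𝔄 b ν₂ ⋙ Up.liftF (HolTHPlusPair.forgetTH 𝔄))
  | true, _, _, ArchEdge.postLogId => 𝟙 _
  | true, _, _, ArchEdge.shell =>
      Functor.whiskerRight (Up.liftT (HolTFPair.iotaTimesPlus 𝔄)) (Up.liftF (HolTHPlusPair.forgetTH 𝔄))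
  | true, _, _, ArchEdge.multToSpaceLink => Up.liftT (HolTFPair.inclTimes 𝔄)
  | false, _, _, _ => 𝟙 _

/-- `Λ_ν ∘ λ⊞ ⋙ (𝒩⊞ → 𝒩) = λ⊞ ⋙ (𝒩⊞ → 𝒩)` for the model's (identity) log-Frobenius functor. [cite: MochizukiAbsTopIII2015, Def 5.4 (vii) p. 128] -/
theorem frobeniusTwist_id_comp_plus_forget (c : Bool) (b : Bool) (ν : LogVertex b) :
    (frobeniusTwist (𝟭 (Up (HolTFPair 𝔄))) c ⋙ archLamPlus 𝔄 b ν) ⋙ Up.liftF (HolTHPlusPair.forgetTH 𝔄) =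
      archLamPlus 𝔄 b ν ⋙ Up.liftF (HolTHPlusPair.forgetTH 𝔄) := by
  cases c <;> rfl

/-- Whiskering a canonical identification is the canonical identification. [folklore] -/
private theorem whiskerRight_eqToHom' {C D E : Type*} [Category C] [Category D] [Category E] {G G' : C ⥤ D}
    (h : G = G') (F : D ⥤ E) : Functor.whiskerRight (eqToHom h) F = eqToHom (by rw [h]) := by
  subst h
  simp [Functor.whiskerRight_id']

/-- On `Γ⃗^⋉_v`, before the twist, the `TS`-valued core IS the `⊞`-valued core pushed down to `TH` (on the nose: `exp_k` as a
`TH⊞`-morphism forgotten to `TH` is `exp_k`, abc-iut-L4-t8's `iotaTimesPlus_forgetTH`). [cite: MochizukiAbsTopIII2015, Def 5.4 (vii) p. 128] -/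
theorem archIotaTSPlusCore_toTS_core (b : Bool) {ν₁ ν₂ : LogVertex b} (ε : LogEdgeLtimes b ν₁ ν₂) :
    archIotaTSPlusCore 𝔄 b ε.toTS = Functor.whiskerRight (archIotaPlusCore 𝔄 b ε) (Up.liftF (HolTHPlusPair.forgetTH 𝔄)) := by
  cases b
  · exact (Functor.whiskerRight_id' _).symm
  · obtain ⟨e, he⟩ := ε
    cases e
    · exact (Functor.whiskerRight_id' _).symm
    · rfl
    · exact False.elim he

/-- On `Γ⃗^⋉_v` the `TS`-valued homotopy is `ι⊞ ▹ (𝒩⊞_v → 𝒩_v)` (Def 5.4 (vii)), per Boolean.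
[cite: MochizukiAbsTopIII2015, Def 5.4 (vii) p. 128] -/
theorem archIotaTSPlusCore_toTS (b : Bool) {ν₁ ν₂ : LogVertex b} (ε : LogEdgeLtimes b ν₁ ν₂) :
    eqToHom (frobeniusTwist_id_comp_plus_forget 𝔄 ν₁.isPostLog b ν₁) ≫ archIotaTSPlusCore 𝔄 b ε.toTS =
      Functor.whiskerRight (archIotaPlus 𝔄 b ε) (Up.liftF (HolTHPlusPair.forgetTH 𝔄)) := by
  rw [archIotaPlus, Functor.whiskerRight_comp, whiskerRight_eqToHom', archIotaTSPlusCore_toTS_core]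

variable (Vmod : Type (u + 1)) (isArc : Vmod → Bool)

/-- ★ **The `TS`-valued homotopy datum on the archimedean `⋉`-carrier of record** (an inhabitant of `TSHomotopies` at
`archGenuinePlus 𝔄 V isArc`): `archIotaTSPlusCore` at every place after the canonical identification `Λ_ν ∘ λ⊞ = λ⊞`, with the
printed requirement `ι|_{Γ⃗^⋉} = ι⊞ ▹ (𝒩⊞ → 𝒩)`. [cite: MochizukiAbsTopIII2015, Def 5.4 (vii) p. 128] -/
noncomputable def archGenuinePlusTS : (archGenuinePlus 𝔄 Vmod isArc).TSHomotopies where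
  iota v _ _ ε := eqToHom (frobeniusTwist_id_comp_plus_forget 𝔄 _ (isArc v) _) ≫ archIotaTSPlusCore 𝔄 (isArc v) ε
  iota_toTS v _ _ ε := archIotaTSPlusCore_toTS 𝔄 (isArc v) ε

/-- Per-Boolean form of `archGenuinePlus_iotaOverTS`: along every edge of `Γ⃗^log_v`, at each object both sides are composites
of identities of the structure-orbispace `𝕏` (the `EA`-components of `exp_k` and of `k^× ↪ k` are `𝟙 𝕏`; every structure
isomorphism of the carrier is `Iso.refl`). [cite: MochizukiAbsTopIII2015, Def 5.4 (vii) p. 128] -/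
private theorem archGenuinePlus_iotaOverTS_aux (b : Bool) {ν₁ ν₂ : LogVertex b} (ε : LogEdgeTS b ν₁ ν₂) :
    Functor.whiskerRight (eqToHom (frobeniusTwist_id_comp_plus_forget 𝔄 ν₁.isPostLog b ν₁) ≫ archIotaTSPlusCore 𝔄 b ε)
        (Up.liftF (HolTHPair.toEA 𝔄)) =
      (Functor.associator _ _ _).hom ≫
        (Functor.associator _ _ _ ≪≫ Functor.isoWhiskerLeft _ (archLamPlusOver 𝔄 b ν₁) ≪≫
            (archGenuinePlus 𝔄 Vmod isArc).twistOver ν₁.isPostLog).hom ≫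
          (archLamPlusOver 𝔄 b ν₂).inv ≫ (Functor.associator _ _ _).inv := by
  ext X₀
  cases b
  · cases ν₁ <;>
    · change (𝟙 (X₀.down.X) ≫ 𝟙 (X₀.down.X) : X₀.down.X ⟶ X₀.down.X) =
          𝟙 (X₀.down.X) ≫ ((𝟙 (X₀.down.X) ≫ (𝟙 (X₀.down.X) ≫ 𝟙 (X₀.down.X))) ≫
            (𝟙 (X₀.down.X) ≫ 𝟙 (X₀.down.X)))
      simp
  · cases ε <;>
    · change (𝟙 (X₀.down.X) ≫ 𝟙 (X₀.down.X) : X₀.down.X ⟶ X₀.down.X) =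
          𝟙 (X₀.down.X) ≫ ((𝟙 (X₀.down.X) ≫ (𝟙 (X₀.down.X) ≫ 𝟙 (X₀.down.X))) ≫
            (𝟙 (X₀.down.X) ≫ 𝟙 (X₀.down.X)))
      simp

/-- ★ **`IotaOverTS` HOLDS for `archGenuinePlusTS`**: its `TS`-valued `ι_{v,ε}` lie over `Th•[Z] = EA` along every edge of
`Γ⃗^log_v`. [cite: MochizukiAbsTopIII2015, Def 5.4 (vii) p. 128] -/
theorem archGenuinePlus_iotaOverTS : (archGenuinePlusTS 𝔄 Vmod isArc).IotaOverTS :=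
  fun v _ _ ε => archGenuinePlus_iotaOverTS_aux 𝔄 Vmod isArc (isArc v) ε

/-- a `TS`-datum on the archimedean `⋉`-carrier EXISTS (with `IotaOverTS`). [cite: MochizukiAbsTopIII2015, Def 5.4 (vii) p. 128] -/
theorem archGenuinePlus_exists_iotaOverTS :
    ∃ T : (archGenuinePlus 𝔄 Vmod isArc).TSHomotopies, T.IotaOverTS :=
  ⟨archGenuinePlusTS 𝔄 Vmod isArc, archGenuinePlus_iotaOverTS 𝔄 Vmod isArc⟩

end ArchTS

end LogFrobeniusSettingLtimes

end Literature.AnabelianGeometry.AbsoluteAnabelian
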